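import Mathlib
import HarnessLib
import Summits.HubbardSuperconductivity.HubbardSuperconductivity.Theorems.KLProgrammeC4aCharPolyReading

/-!
# Route `KLProgramme` — crux C4a, THE TADPOLE REPRESENTATION (LAYER-1 glue, continuum form): the one-line part of the scale increment of the local part
# is the continuum tadpole `Σ_{p₀,y} 𝒟_{p₀}(P, y)·L⁻²S_{p₀}(y)` of an explicit trigonometric-polynomial vertex, at EVERY continuum external momentum `P`

Cell `gate-hubbard-kl`, lane hubbard-kl-c4a-1 (g5); helper for stub (C) `stub_twoLeg_curvature` of the engine-flow child `KLRegimeEngineV17F2`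
(stmt-HubbardSuperconductivity-20437); memo HOME/hubbard-kl-c4a-1/C4A-PLAN.md §16.4 (1)–(5), §16.5 (i)–(v).  By `…C4aCharPolyReading.klLocalPart_succ_sub_eq_avg8`
the increment `ν_{n+1}(K)(θ) − ν_n(K)(θ)` is `⅛ Σ_{θ′}` of `Re[localReadingCont(Δ_S 𝒱_n) + localReadingCont(R₁) + localReadingCont(R₂)](k_F^K(θ′))` over the eight
images `θ′` of the angle.  This file identifies the ONE-LINE term `localReadingCont β (Δ_S W)` — for ANY Grassmann element `W`, slice cutoffs `Λ ≤ Λ′` and frame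
`K` — with an explicit continuum tadpole:

* §1 `loopCoeffCont β W κ p₀ σ τ P y` (the coefficient `C(y)` of `…C4aMomentumKernelTrigPoly.kernel_four_loop_eq_sum_torusChar` with the external character
  `χ_{k⃗}(x⃗₀ − x⃗₁)` replaced by the plane wave `e^{iP·(x⃗₀−x⃗₁)~}` at a continuum momentum), `tadpoleCoeff β W p₀ P y = 6βL⁴·Σ_{σ,τ,±} loopCoeffCont`,
  `tadpoleCont β μ K Λ Λ′ W P = Σ_{p₀,y} tadpoleCoeff·L⁻²S_{p₀}(y)` (`S_{p₀}(y) = Σ_{q⃗} ŝ(ω_{p₀}, e_K(p_q⃗))χ_{q⃗}(y)`, the lattice Fourier transform of the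
  slice weight — the object `…C4aSliceTransform` replaces by the tube Fourier integral), and the continuum vertex
  `tadpoleVertex β W p₀ (P, q) = Σ_y tadpoleCoeff β W p₀ P y·e^{iq·ỹ}` (jointly a trigonometric polynomial: the `V (levelPoint μ K 0 θ) q` slot of
  `…C4aTubeTadpoleCert.norm_iteratedDeriv_tubeTadpole_le_cert`);
* §2 **`localReadingCont_laplacian_latticeMomentum`** — at every lattice momentum `localReadingCont β (Δ_S W) (p_k⃗) = tadpoleCont … (p_k⃗)` (LAYER 1's
  textbook tadpole `selfEnergy_grassmannLaplacian_hubbardCovSliceCT` + the loop regrouping `sum_slice_mul_vertexFn_tadpoleLegs_eq` + the external pair);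
* §3 both sides are canonical character polynomials (`isCharPoly_tadpoleCont`), hence **`localReadingCont_laplacian_eq_tadpoleCont`**: the identity at EVERY
  continuum momentum (`IsCharPoly.eq_of_eq_latticeMomentum`) — in particular at the eight Fermi points `k_F^K(θ′)` off the lattice;
* §4 `tadpoleVertex_apply_toLp` / `tadpoleCont_eq_sum_coeff` — the shapes `…C4aSliceTransform.norm_sum_coeff_mul_sliceTransform_sub_tubeIntegral_le` consumes
  (coefficient family `C := tadpoleCoeff β W p₀ P`, one `p₀` at a time); the Poisson step, the coefficient mass and the joint smoothness are `…C4aTadpoleRepresentationTube`.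

Exact identities and definitions; nothing is asserted about the Hubbard model's sizes; nothing asserts superconductivity.
References: BGM 2006 §2.1 (2.3)–(2.5), §2.3 (2.17)–(2.23) [cite: BenfattoGiulianiMastropietro2006]; Salmhofer 1998 §5.1 [cite: Salmhofer1998].
-/

noncomputable section

namespace Summit.HubbardSuperconductivity.HubbardSuperconductivity.Theorems.C4a

set_option linter.dupNamespace false -- summit = problem name (single-conjunct summit), D-0017

open Real Finset Literature.MathematicalPhysics.QuantumLattice Literature.Probability.LatticeModels GrassmannAlgebra
open Summit.HubbardSuperconductivity.HubbardSuperconductivity.Theorems.KLRegimeSplit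
open Summit.HubbardSuperconductivity.HubbardSuperconductivity.Theorems.KLProgrammeLegKernels
open Summit.HubbardSuperconductivity.HubbardSuperconductivity.Theorems.KLRegimeWick
open Summit.HubbardSuperconductivity.HubbardSuperconductivity.Theorems.DispersionFlow

variable {L M : ℕ} [NeZero L] [NeZero M]

/-! ## §1 The continuum loop coefficient, the tadpole coefficient, the continuum tadpole and its vertex -/

/-- **The continuum loop coefficient** at external frequency `κ`, slice frequency `p₀`, spins `σ, τ`, external momentum `P ∈ ℝ²` and loop position `y`:
`|Λ|⁻⁴·Σ_{x : x⃗₃ − x⃗₂ = y} W₄(x)·(e^{iω_κ(t₀−t₁)}·e^{i Σ_j P_j (x⃗₀−x⃗₁)~_j}·e^{iω_{p₀}(t₃−t₂)})` — the coefficient `C(y)` of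
`kernel_four_loop_eq_sum_torusChar` with the external character continued off the lattice (`loopCoeff_latticeMomentum`). -/
def loopCoeffCont (β : ℝ) (W : HubbardGrassmann L M) (κ p₀ : MatsubaraIdx M) (σ τ : Fin 2) (P : Fin 2 → ℝ) (y : TorusSite 2 L) : ℂ :=
  (((Fintype.card (SpaceTimeIdx L M) : ℂ) ^ 4)⁻¹ *
    ∑ x ∈ (Finset.univ : Finset (Fin 4 → SpaceTimeIdx L M)).filter (fun x => (x 3).2 - (x 2).2 = y),
      positionKernel L M β W 4 (fun i => ((x i, ![σ, σ, τ, τ] i), (![0, 1, 1, 0] : Fin 4 → Fin 2) i)) *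
        (Complex.exp (((matsubaraFreq β M κ * (imagTime β M (x 0).1 - imagTime β M (x 1).1) : ℝ) : ℂ) * Complex.I) *
          Complex.exp (((∑ j, P j * ((((x 0).2 - (x 1).2) j).valMinAbs : ℝ) : ℝ) : ℂ) * Complex.I) *
          Complex.exp (((matsubaraFreq β M p₀ * (imagTime β M (x 3).1 - imagTime β M (x 2).1) : ℝ) : ℂ) * Complex.I)))

/-- **The tadpole coefficient** `𝒟_{p₀}(P, y) = 6βL⁴·Σ_{σ,τ} Σ_{κ ∈ {ω₀, −ω₀}} loopCoeffCont β W κ p₀ σ τ P y` — the localised reading's prefactors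
`¼·(βL²)⁻²·4!(βL²)³·L² = 6βL⁴` absorbed (the `L²` compensates the `L⁻²` of the normalised slice transform). -/
def tadpoleCoeff (β : ℝ) (W : HubbardGrassmann L M) (p₀ : MatsubaraIdx M) (P : Fin 2 → ℝ) (y : TorusSite 2 L) : ℂ :=
  ((6 * β * (L : ℝ) ^ 4 : ℝ) : ℂ) *
    ∑ σ : Fin 2, ∑ τ : Fin 2, ∑ κ : Fin 2, loopCoeffCont β W ((![omega0 M, (omega0 M).rev] : Fin 2 → MatsubaraIdx M) κ) p₀ σ τ P y

/-- **The continuum tadpole** of the one-line term at external momentum `P ∈ ℝ²`: `Σ_{p₀} Σ_y 𝒟_{p₀}(P, y)·(L⁻²·Σ_{q⃗} ŝ_{Λ,Λ′}(ω_{p₀}, e_K(p_q⃗))·χ_{q⃗}(y))`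
(the loop momentum still summed over the lattice; `…C4aSliceTransform` trades `L⁻²S_{p₀}(y)` for `(2π)⁻²∫_{tube} ŝ(e_K q)e^{iq·ỹ}dq`). -/
def tadpoleCont (β μ : ℝ) (K : TrigPolyC4v) (Λ Λ' : ℝ) (W : HubbardGrassmann L M) (P : Fin 2 → ℝ) : ℂ :=
  ∑ p₀ : MatsubaraIdx M, ∑ y : TorusSite 2 L, tadpoleCoeff β W p₀ P y *
    (((L : ℂ) ^ 2)⁻¹ * ∑ q : TorusSite 2 L,
      sliceSymbolFnXi (β * (L : ℝ) ^ 2) 0 Λ Λ' (matsubaraFreq β M p₀) (frameLevel μ K (WithLp.toLp 2 (latticeMomentum L q))) * torusChar q y)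

/-- **The continuum tadpole VERTEX** at slice frequency `p₀`: `V_{p₀}(P, q) = Σ_y 𝒟_{p₀}(P, y)·e^{i Σ_i ỹ_i q_i}` on `Momentum × Momentum` — a trigonometric
polynomial in both slots (the fat vertex `W₄(P, P, q, q)` read through plane waves with centred frequencies). -/
def tadpoleVertex (β : ℝ) (W : HubbardGrassmann L M) (p₀ : MatsubaraIdx M) (Pm q : Momentum) : ℂ :=
  ∑ y : TorusSite 2 L, tadpoleCoeff β W p₀ (WithLp.ofLp Pm) y * Complex.exp (((∑ i, ((y i).valMinAbs : ℝ) * q i : ℝ) : ℂ) * Complex.I)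

/-! ## §2 At lattice momenta: the one-line reading IS the continuum tadpole -/

omit [NeZero M] in
/-- The external pair as time phase × plane wave with the centred frequency: `conj pw₀(k,x₀)·conj pw₁(k,x₁) = e^{iω_k(t₀−t₁)}·e^{i p_k⃗·(x⃗₀−x⃗₁)~}`. -/
theorem extPair_cexp (β : ℝ) (k : FreqMomentum L M) (x₀ x₁ : SpaceTimeIdx L M) :
    (starRingEnd ℂ) (hubbardPlaneWave L M β 0 k x₀) * (starRingEnd ℂ) (hubbardPlaneWave L M β 1 k x₁) =
      Complex.exp (((matsubaraFreq β M k.1 * (imagTime β M x₀.1 - imagTime β M x₁.1) : ℝ) : ℂ) * Complex.I) *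
        Complex.exp (((∑ j, latticeMomentum L k.2 j * (((x₀.2 - x₁.2) j).valMinAbs : ℝ) : ℝ) : ℂ) * Complex.I) := by
  rw [conj_hubbardPlaneWave_zero_mul_conj_hubbardPlaneWave_one, torusChar_eq_cexp_valMinAbs]

omit [NeZero M] in
/-- **At a lattice external momentum the continuum loop coefficient IS LAYER 2's `C(y)`.** [cite: BenfattoGiulianiMastropietro2006, §2.3 (2.17)] -/
theorem loopCoeff_latticeMomentum (β : ℝ) (W : HubbardGrassmann L M) (κ p₀ : MatsubaraIdx M) (σ τ : Fin 2) (k y : TorusSite 2 L) :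
    (((Fintype.card (SpaceTimeIdx L M) : ℂ) ^ 4)⁻¹ *
        ∑ x ∈ (Finset.univ : Finset (Fin 4 → SpaceTimeIdx L M)).filter (fun x => (x 3).2 - (x 2).2 = y),
          positionKernel L M β W 4 (fun i => ((x i, ![σ, σ, τ, τ] i), (![0, 1, 1, 0] : Fin 4 → Fin 2) i)) *
            ((starRingEnd ℂ) (hubbardPlaneWave L M β 0 (κ, k) (x 0)) * (starRingEnd ℂ) (hubbardPlaneWave L M β 1 (κ, k) (x 1)) *
              Complex.exp (((matsubaraFreq β M p₀ * (imagTime β M (x 3).1 - imagTime β M (x 2).1) : ℝ) : ℂ) * Complex.I))) =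
      loopCoeffCont β W κ p₀ σ τ (latticeMomentum L k) y := by
  unfold loopCoeffCont
  simp_rw [extPair_cexp]

omit [NeZero L] in
/-- The torus band is the frame level at the lattice momentum (local copy of `…EngineFrameLevelCount.nambuXiCT_eq_frameLevel`). -/
theorem nambuXiCT_eq_frameLevel' (μ : ℝ) (K : TrigPolyC4v) (k : TorusSite 2 L) :
    nambuXiCT L μ K k = frameLevel μ K (WithLp.toLp 2 (latticeMomentum L k)) := by
  simp only [nambuXiCT, frameLevel, torusBand, squareDispersion, Fin.sum_univ_two]
  simp

/-- Regrouping of the localised reading's double sum (pure finite-sum algebra): with `E⁻¹·c = 4·K·Lᵢ`,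
`¼Σ_σ[E⁻¹c·Σ_{p,τ,y} A_{σκ₀pτy}S_{py} + E⁻¹c·Σ_{p,τ,y} A_{σκ₁pτy}S_{py}] = Σ_{p,y} (K·Σ_{σ,τ,κ} A_{σ,(κ₀,κ₁)_κ,p,τ,y})·(Lᵢ·S_{py})`. -/
private theorem regroup₄ {ιp ιy ν : Type*} [Fintype ιp] [Fintype ιy] (A : Fin 2 → ν → ιp → Fin 2 → ιy → ℂ) (S : ιp → ιy → ℂ)
    (κ₀ κ₁ : ν) {E c K Li : ℂ} (h : E⁻¹ * c = 4 * (K * Li)) :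
    (∑ σ : Fin 2, (E⁻¹ * (c * ∑ p, ∑ τ : Fin 2, ∑ y, A σ κ₀ p τ y * S p y) +
        E⁻¹ * (c * ∑ p, ∑ τ : Fin 2, ∑ y, A σ κ₁ p τ y * S p y))) / 4 =
      ∑ p, ∑ y, (K * ∑ σ : Fin 2, ∑ τ : Fin 2, ∑ κ : Fin 2, A σ ((![κ₀, κ₁] : Fin 2 → ν) κ) p τ y) * (Li * S p y) := by
  have h' : ∀ Y, E⁻¹ * (c * Y) = 4 * (K * Li) * Y := fun Y => by rw [← mul_assoc, h]
  simp only [h', Fin.sum_univ_two, Matrix.cons_val_zero, Matrix.cons_val_one, Finset.mul_sum, mul_add, add_mul,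
    ← Finset.sum_add_distrib, Finset.sum_div]
  refine Finset.sum_congr rfl fun p _ => Finset.sum_congr rfl fun y _ => ?_
  ring

/-- The prefactor identity `(βL²)⁻²·4!(βL²)³ = 4·(6βL⁴)·L⁻²` (`β ≠ 0`). -/
private theorem prefactor_eq {β : ℝ} (hβ : β ≠ 0) :
    ((((β * (L : ℝ) ^ 2) ^ 2 : ℝ) : ℂ))⁻¹ * ((((4 : ℕ).factorial : ℝ) * (β * (L : ℝ) ^ 2) ^ (4 - 1) : ℝ) : ℂ) =
      4 * (((6 * β * (L : ℝ) ^ 4 : ℝ) : ℂ) * ((L : ℂ) ^ 2)⁻¹) := by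
  have hL : (L : ℂ) ≠ 0 := Nat.cast_ne_zero.2 (NeZero.ne L)
  have hβ' : (β : ℂ) ≠ 0 := Complex.ofReal_ne_zero.2 hβ
  norm_num [Nat.factorial]
  field_simp
  ring

/-- **THE ONE-LINE READING AT A LATTICE MOMENTUM IS THE CONTINUUM TADPOLE** (`β ≠ 0`; any `W`, frame `K`, cutoffs `Λ, Λ′`):
`localReadingCont β (Δ_S W) (p_k⃗) = tadpoleCont β μ K Λ Λ′ W (p_k⃗)`, `S = C^K_{(Λ,Λ′]}`. [cite: BenfattoGiulianiMastropietro2006, §2.3 (2.17)–(2.23)] -/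
theorem localReadingCont_laplacian_latticeMomentum {β : ℝ} (hβ : β ≠ 0) (μ : ℝ) (K : TrigPolyC4v) (Λ Λ' : ℝ) (W : HubbardGrassmann L M)
    (k : TorusSite 2 L) :
    localReadingCont β (grassmannLaplacian ℂ (hubbardCovSliceCT L M β μ 0 K Λ Λ') W) (latticeMomentum L k) =
      tadpoleCont β μ K Λ Λ' W (latticeMomentum L k) := by
  -- LAYER 1's loop sum, per external frequency and spin, regrouped by the loop position
  have h4 : ∀ (κ : MatsubaraIdx M) (σ : Fin 2),
      ∑ p : FreqMomentum L M × Fin 2, sliceSymbolFnXi (β * (L : ℝ) ^ 2) 0 Λ Λ' (matsubaraFreq β M p.1.1) (nambuXiCT L μ K p.1.2) *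
        vertexFn L M β W (2 + 2) (Fin.snoc (Fin.snoc (![(((κ, k), σ), 0), (((κ, k), σ), 1)] : Fin 2 → HubbardFieldIdx L M)
          ((p, 1) : HubbardFieldIdx L M) : Fin (2 + 1) → HubbardFieldIdx L M) (p, 0)) = _ :=
    fun κ σ => sum_slice_mul_vertexFn_tadpoleLegs_eq hβ W (κ, k) σ
      (fun q : FreqMomentum L M => sliceSymbolFnXi (β * (L : ℝ) ^ 2) 0 Λ Λ' (matsubaraFreq β M q.1) (nambuXiCT L μ K q.2))
  unfold localReadingCont tadpoleCont tadpoleCoeff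
  simp_rw [← selfEnergy_eq_selfEnergyCont hβ, selfEnergy_grassmannLaplacian_hubbardCovSliceCT hβ μ K Λ Λ' W, h4, loopCoeff_latticeMomentum,
    nambuXiCT_eq_frameLevel']
  exact regroup₄ (fun σ κ p₀ τ y => loopCoeffCont β W κ p₀ σ τ (latticeMomentum L k) y) _ (omega0 M) (omega0 M).rev (prefactor_eq hβ)

/-! ## §3 Both sides are canonical character polynomials: the identity at every continuum momentum -/

omit [NeZero M] in
/-- A plane wave between two constants is a character polynomial. -/
private theorem isCharPoly_mul_cexp_mul (a b d : ℂ) (z : TorusSite 2 L) :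
    IsCharPoly L fun P => a * (b * Complex.exp (((∑ j, P j * ((z j).valMinAbs : ℝ) : ℝ) : ℂ) * Complex.I) * d) := by
  obtain ⟨c, hc⟩ := isCharPoly_const_mul_cexp (L := L) (a * b * d) z
  refine ⟨c, fun P => ?_⟩
  rw [← hc P]
  ring

omit [NeZero M] in
/-- The continuum loop coefficient is a character polynomial of the external momentum. -/
theorem isCharPoly_loopCoeffCont (β : ℝ) (W : HubbardGrassmann L M) (κ p₀ : MatsubaraIdx M) (σ τ : Fin 2) (y : TorusSite 2 L) :
    IsCharPoly L fun P => loopCoeffCont β W κ p₀ σ τ P y := by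
  unfold loopCoeffCont
  exact (IsCharPoly.sum _ fun x => isCharPoly_mul_cexp_mul _ _ _ _).const_mul _

/-- The tadpole coefficient is a character polynomial of the external momentum. -/
theorem isCharPoly_tadpoleCoeff (β : ℝ) (W : HubbardGrassmann L M) (p₀ : MatsubaraIdx M) (y : TorusSite 2 L) :
    IsCharPoly L fun P => tadpoleCoeff β W p₀ P y := by
  unfold tadpoleCoeff
  exact (IsCharPoly.sum _ fun σ => IsCharPoly.sum _ fun τ => IsCharPoly.sum _ fun κ => isCharPoly_loopCoeffCont β W _ p₀ σ τ y).const_mul _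

/-- The continuum tadpole is a canonical character polynomial. -/
theorem isCharPoly_tadpoleCont (β μ : ℝ) (K : TrigPolyC4v) (Λ Λ' : ℝ) (W : HubbardGrassmann L M) :
    IsCharPoly L (tadpoleCont β μ K Λ Λ' W) := by
  unfold tadpoleCont
  exact IsCharPoly.sum _ fun p₀ => IsCharPoly.sum _ fun y => (isCharPoly_tadpoleCoeff β W p₀ y).mul_const _

/-- **THE ONE-LINE READING IS THE CONTINUUM TADPOLE AT EVERY CONTINUUM MOMENTUM** (`β ≠ 0`; any `W`, frame `K`, cutoffs): for all `P ∈ ℝ²`,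
`localReadingCont β (Δ_S W) P = tadpoleCont β μ K Λ Λ′ W P` — in particular at the eight Fermi points `k_F^K(θ′)` of `klLocalPart_succ_sub_eq_avg8`.
[cite: BenfattoGiulianiMastropietro2006, §2.3 (2.17)–(2.23)] -/
theorem localReadingCont_laplacian_eq_tadpoleCont {β : ℝ} (hβ : β ≠ 0) (μ : ℝ) (K : TrigPolyC4v) (Λ Λ' : ℝ) (W : HubbardGrassmann L M)
    (P : Fin 2 → ℝ) :
    localReadingCont β (grassmannLaplacian ℂ (hubbardCovSliceCT L M β μ 0 K Λ Λ') W) P = tadpoleCont β μ K Λ Λ' W P :=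
  (isCharPoly_localReadingCont β _).eq_of_eq_latticeMomentum (isCharPoly_tadpoleCont β μ K Λ Λ' W)
    (localReadingCont_laplacian_latticeMomentum hβ μ K Λ Λ' W) P

/-- **The engine instance**: the one-line term of `klLocalPart_succ_sub_eq_avg8` (`W = 𝒱_n[K]`, `S = C^K_{(Λ_{n+1},Λ_n]}`) is `tadpoleCont` at scale `n`. -/
theorem localReadingCont_laplacian_klEffectiveAction {β : ℝ} (hβ : β ≠ 0) (U μ : ℝ) (K : TrigPolyC4v) (n : ℕ) (P : Fin 2 → ℝ) :
    localReadingCont β (grassmannLaplacian ℂ (hubbardCovSliceCT L M β μ 0 K (klScale klE0 (n + 1)) (klScale klE0 n))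
        (klEffectiveAction L M β U μ K klE0 n)) P =
      tadpoleCont β μ K (klScale klE0 (n + 1)) (klScale klE0 n) (klEffectiveAction L M β U μ K klE0 n) P :=
  localReadingCont_laplacian_eq_tadpoleCont hβ μ K _ _ _ P

/-! ## §4 The shapes the Poisson step consumes -/

/-- The vertex at `(toLp P, q)` reads the tadpole coefficients at `P`. -/
theorem tadpoleVertex_apply_toLp (β : ℝ) (W : HubbardGrassmann L M) (p₀ : MatsubaraIdx M) (P : Fin 2 → ℝ) (q : Momentum) :
    tadpoleVertex β W p₀ (WithLp.toLp 2 P) q =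
      ∑ y : TorusSite 2 L, tadpoleCoeff β W p₀ P y * Complex.exp (((∑ i, ((y i).valMinAbs : ℝ) * q i : ℝ) : ℂ) * Complex.I) := by
  simp [tadpoleVertex]

/-- `tadpoleCont` one slice frequency at a time, in the shape of `…C4aSliceTransform.norm_sum_coeff_mul_sliceTransform_sub_tubeIntegral_le`
(coefficient family `C := tadpoleCoeff β W p₀ P`, profile `f := ŝ_{Λ,Λ′}(ω_{p₀}, ·)`). -/
theorem tadpoleCont_eq_sum_coeff (β μ : ℝ) (K : TrigPolyC4v) (Λ Λ' : ℝ) (W : HubbardGrassmann L M) (P : Fin 2 → ℝ) :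
    tadpoleCont β μ K Λ Λ' W P =
      ∑ p₀ : MatsubaraIdx M, ∑ y : TorusSite 2 L, tadpoleCoeff β W p₀ P y *
        (((L : ℂ) ^ 2)⁻¹ * ∑ q : TorusSite 2 L,
          (fun ξ : ℝ => sliceSymbolFnXi (β * (L : ℝ) ^ 2) 0 Λ Λ' (matsubaraFreq β M p₀) ξ)
            (frameLevel μ K (WithLp.toLp 2 (latticeMomentum L q))) * torusChar q y) := rfl

/-! ## §5 Linearity in the Grassmann element (the Hartree / second-order splits `𝒱_n = U·V + (𝒱_n − U·V)`) -/

omit [NeZero M] in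
/-- The position-space kernels are homogeneous in the Grassmann element. -/
theorem positionKernel_smul' (β : ℝ) (c : ℂ) (G : HubbardGrassmann L M) (m : ℕ) (ξ : Fin m → (SpaceTimeIdx L M × Fin 2) × Fin 2) :
    positionKernel L M β (c • G) m ξ = c * positionKernel L M β G m ξ := by
  simp only [positionKernel, kernel_smul, Finset.mul_sum]
  exact Finset.sum_congr rfl fun k _ => by ring

omit [NeZero M] in
/-- `loopCoeffCont` is additive in the Grassmann element. -/
theorem loopCoeffCont_add (β : ℝ) (W₁ W₂ : HubbardGrassmann L M) (κ p₀ : MatsubaraIdx M) (σ τ : Fin 2) (P : Fin 2 → ℝ) (y : TorusSite 2 L) :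
    loopCoeffCont β (W₁ + W₂) κ p₀ σ τ P y = loopCoeffCont β W₁ κ p₀ σ τ P y + loopCoeffCont β W₂ κ p₀ σ τ P y := by
  unfold loopCoeffCont
  rw [← mul_add, ← Finset.sum_add_distrib]
  congr 1
  exact Finset.sum_congr rfl fun x _ => by rw [positionKernel_add', add_mul]

omit [NeZero M] in
/-- `loopCoeffCont` is homogeneous in the Grassmann element. -/
theorem loopCoeffCont_smul (β : ℝ) (c : ℂ) (W : HubbardGrassmann L M) (κ p₀ : MatsubaraIdx M) (σ τ : Fin 2) (P : Fin 2 → ℝ) (y : TorusSite 2 L) :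
    loopCoeffCont β (c • W) κ p₀ σ τ P y = c * loopCoeffCont β W κ p₀ σ τ P y := by
  unfold loopCoeffCont
  rw [Finset.mul_sum, Finset.mul_sum, Finset.mul_sum]
  exact Finset.sum_congr rfl fun x _ => by rw [positionKernel_smul']; ring

/-- **`tadpoleCoeff` is additive in the Grassmann element.** -/
theorem tadpoleCoeff_add (β : ℝ) (W₁ W₂ : HubbardGrassmann L M) (p₀ : MatsubaraIdx M) (P : Fin 2 → ℝ) (y : TorusSite 2 L) :
    tadpoleCoeff β (W₁ + W₂) p₀ P y = tadpoleCoeff β W₁ p₀ P y + tadpoleCoeff β W₂ p₀ P y := by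
  unfold tadpoleCoeff
  rw [← mul_add, ← Finset.sum_add_distrib]
  congr 1
  refine Finset.sum_congr rfl fun σ _ => ?_
  rw [← Finset.sum_add_distrib]
  refine Finset.sum_congr rfl fun τ _ => ?_
  rw [← Finset.sum_add_distrib]
  exact Finset.sum_congr rfl fun κ _ => loopCoeffCont_add β W₁ W₂ _ p₀ σ τ P y

/-- **`tadpoleCoeff` is homogeneous in the Grassmann element.** -/
theorem tadpoleCoeff_smul (β : ℝ) (c : ℂ) (W : HubbardGrassmann L M) (p₀ : MatsubaraIdx M) (P : Fin 2 → ℝ) (y : TorusSite 2 L) :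
    tadpoleCoeff β (c • W) p₀ P y = c * tadpoleCoeff β W p₀ P y := by
  unfold tadpoleCoeff
  simp_rw [loopCoeffCont_smul, ← Finset.mul_sum]
  ring

/-- **`tadpoleVertex` is additive** — `CoMovingJetsL1.add` then splits the (L3) dominators along `𝒱_n = U·V + (𝒱_n − U·V)`. -/
theorem tadpoleVertex_add (β : ℝ) (W₁ W₂ : HubbardGrassmann L M) (p₀ : MatsubaraIdx M) :
    tadpoleVertex β (W₁ + W₂) p₀ = fun Pm q => tadpoleVertex β W₁ p₀ Pm q + tadpoleVertex β W₂ p₀ Pm q := by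
  funext Pm q
  unfold tadpoleVertex
  rw [← Finset.sum_add_distrib]
  exact Finset.sum_congr rfl fun y _ => by rw [tadpoleCoeff_add, add_mul]

/-- **`tadpoleVertex` is homogeneous** (`CoMovingJetsL1.const_smul`). -/
theorem tadpoleVertex_smul (β : ℝ) (c : ℂ) (W : HubbardGrassmann L M) (p₀ : MatsubaraIdx M) :
    tadpoleVertex β (c • W) p₀ = fun Pm q => c * tadpoleVertex β W p₀ Pm q := by
  funext Pm q
  unfold tadpoleVertex
  rw [Finset.mul_sum]
  exact Finset.sum_congr rfl fun y _ => by rw [tadpoleCoeff_smul, mul_assoc]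

/-- A subtraction form: `tadpoleVertex β (W − W₀) = tadpoleVertex β W − tadpoleVertex β W₀` pointwise. -/
theorem tadpoleVertex_sub (β : ℝ) (W W₀ : HubbardGrassmann L M) (p₀ : MatsubaraIdx M) (Pm q : Momentum) :
    tadpoleVertex β (W - W₀) p₀ Pm q = tadpoleVertex β W p₀ Pm q - tadpoleVertex β W₀ p₀ Pm q := by
  rw [eq_sub_iff_add_eq, ← show tadpoleVertex β (W - W₀ + W₀) p₀ Pm q = tadpoleVertex β (W - W₀) p₀ Pm q + tadpoleVertex β W₀ p₀ Pm q from
    congrFun (congrFun (tadpoleVertex_add β (W - W₀) W₀ p₀) Pm) q, sub_add_cancel]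

/-- `tadpoleCont` is additive in the Grassmann element. -/
theorem tadpoleCont_add (β μ : ℝ) (K : TrigPolyC4v) (Λ Λ' : ℝ) (W₁ W₂ : HubbardGrassmann L M) (P : Fin 2 → ℝ) :
    tadpoleCont β μ K Λ Λ' (W₁ + W₂) P = tadpoleCont β μ K Λ Λ' W₁ P + tadpoleCont β μ K Λ Λ' W₂ P := by
  unfold tadpoleCont
  rw [← Finset.sum_add_distrib]
  refine Finset.sum_congr rfl fun p₀ _ => ?_
  rw [← Finset.sum_add_distrib]
  exact Finset.sum_congr rfl fun y _ => by rw [tadpoleCoeff_add, add_mul]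

/-! ## §6 At lattice momenta the continuum vertex IS the momentum kernel at the tadpole legs -/

/-- **`tadpoleVertex` at lattice momenta** (`β ≠ 0`, any `W`):
`tadpoleVertex β W p₀ (p_k⃗) (p_q⃗) = 6βL⁴·Σ_{σ,τ} Σ_{κ ∈ {ω₀,−ω₀}} kernel W 4 ((κ,k⃗)σ+, (κ,k⃗)σ−, (p₀,q⃗)τ−, (p₀,q⃗)τ+)` — the (L3) analysts may read the
second-order vertex straight from the momentum kernels of the second cumulant at the tadpole legs (then continue off the lattice by `IsCharPoly`).
[cite: BenfattoGiulianiMastropietro2006, §2.3 (2.17)] -/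
theorem tadpoleVertex_latticeMomentum {β : ℝ} (hβ : β ≠ 0) (W : HubbardGrassmann L M) (p₀ : MatsubaraIdx M) (k q : TorusSite 2 L) :
    tadpoleVertex β W p₀ (WithLp.toLp 2 (latticeMomentum L k)) (WithLp.toLp 2 (latticeMomentum L q)) =
      ((6 * β * (L : ℝ) ^ 4 : ℝ) : ℂ) * ∑ σ : Fin 2, ∑ τ : Fin 2, ∑ κ : Fin 2,
        kernel ℂ W 4 (fun i => ((![(((![omega0 M, (omega0 M).rev] : Fin 2 → MatsubaraIdx M) κ), k), ((![omega0 M, (omega0 M).rev] κ), k),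
          (p₀, q), (p₀, q)] i, ![σ, σ, τ, τ] i), (![0, 1, 1, 0] : Fin 4 → Fin 2) i)) := by
  -- the plane wave at a lattice loop momentum is the character
  have hpw : ∀ y : TorusSite 2 L, Complex.exp (((∑ i, ((y i).valMinAbs : ℝ) * (WithLp.toLp 2 (latticeMomentum L q) : Momentum) i : ℝ) : ℂ) *
      Complex.I) = torusChar q y := by
    intro y
    rw [torusChar_eq_cexp_valMinAbs]
    congr 3
    exact Finset.sum_congr rfl fun i _ => by rw [PiLp.toLp_apply, mul_comm]
  -- the loop sum of the continuum loop coefficient at a lattice external momentum is the momentum kernel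
  have hloop : ∀ (κ' : MatsubaraIdx M) (σ τ : Fin 2),
      ∑ y : TorusSite 2 L, loopCoeffCont β W κ' p₀ σ τ (latticeMomentum L k) y * torusChar q y =
        kernel ℂ W 4 (fun i => ((![(κ', k), (κ', k), (p₀, q), (p₀, q)] i, ![σ, σ, τ, τ] i), (![0, 1, 1, 0] : Fin 4 → Fin 2) i)) := by
    intro κ' σ τ
    rw [kernel_four_loop_eq_sum_torusChar hβ]
    exact Finset.sum_congr rfl fun y _ => by rw [← loopCoeff_latticeMomentum]
  rw [tadpoleVertex_apply_toLp]
  simp_rw [hpw]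
  unfold tadpoleCoeff
  simp_rw [mul_assoc, ← Finset.mul_sum, Finset.sum_mul]
  congr 1
  rw [Finset.sum_comm]
  refine Finset.sum_congr rfl fun σ _ => ?_
  rw [Finset.sum_comm]
  refine Finset.sum_congr rfl fun τ _ => ?_
  rw [Finset.sum_comm]
  exact Finset.sum_congr rfl fun κ _ => hloop _ σ τ

end Summit.HubbardSuperconductivity.HubbardSuperconductivity.Theorems.C4a

end
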